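import Mathlib.Analysis.InnerProductSpace.Dual
import Mathlib.Analysis.InnerProductSpace.Calculus
import Mathlib.Analysis.Normed.Module.HahnBanach
import Mathlib.Analysis.SpecialFunctions.JapaneseBracket
import Literature.Analysis.FunctionSpaces.TestPairingLimits
import HarnessLib

/-!
# The Riesz representation theorems `L² = (L²)*` and `L³ = (L^{3/2})*` on test fields

Analysis/FunctionSpaces support file (all results proved). It serves the discharge of the named
fact `Literature.Analysis.FluidPDE.riesz_L3_of_testField_bound`
(`FluidPDE/NSLerayHopfSereginTrace`; Fonseca–Leoni 2007, Thm. 2.37 with Thm. 2.78), the Riesz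
representation `L³ = (L^{3/2})*` for functionals that are only given on the smooth compactly
supported vector fields, as used by Lemarié-Rieusset 2016 (p. 573) to see that the trace at the
blow-up time of a Kato solution with `‖u(t)‖₃ ≤ M` frequently is an `L³` field.

Let `E` be a finite-dimensional real inner product space with its canonical Lebesgue measure,
and let `Λ` be a real functional on fields `E → E` which is additive and real homogeneous on the
test fields `C_c^∞(E; E)` (`IsTestFunctionOn ⊤`; its values off the test fields are irrelevant).

* `exists_memLp_two_repr_of_testField_bound` — **`(L²)* = L²` on test fields**: if
  `|Λ φ| ≤ C ‖φ‖_{L²}` for all test fields, then `Λ φ = ∫ ⟪G, φ⟫` for some `G ∈ L²(E; E)`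
  (the classes of test fields form a subspace of the Hilbert space `L²(E; E)` on which `Λ`
  is a bounded linear functional — well defined because a.e. equal continuous functions are
  equal; extend it by Hahn–Banach and represent it by the Riesz–Fréchet theorem, Mathlib's
  `InnerProductSpace.toDual`).
* `exists_memLp_three_repr_of_testField_bound` — **`(L^{3/2})* = L³` on test fields**
  (Fonseca–Leoni 2007, Thm. 2.37 for `p = 3/2`, `q = 3`, combined with the density of `C_c^∞`
  in `L^{3/2}`, Thm. 2.78): if `0 ≤ M` and `|Λ φ| ≤ M ‖φ‖_{L^{3/2}}` for all test fields, then
  there is `u ∈ L³(E; E)` with `‖u‖_{L³} ≤ M` and `Λ φ = ∫ ⟪u, φ⟫` for all test fields.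

## The proof of the `L³` statement

Fonseca–Leoni prove Thm. 2.37 through the Radon–Nikodým theorem; here the exponent
`p = 3/2 < 2` allows the classical reduction to the Hilbert space case. With the smooth weight
`w(x) = (1 + |x|²)^{d+1}`, `d = dim E`, one has `w⁻¹ ∈ L⁶` and Hölder's inequality
`‖φ‖_{3/2} ≤ ‖w⁻¹‖₆ ‖w φ‖₂` (`1/6 + 1/2 = 2/3`), so the functional `Λ'(ψ) = Λ(w⁻¹ ψ)` is
bounded in the `L²` norm on test fields; by the `L²` statement `Λ'(ψ) = ∫⟪G, ψ⟫` with
`G ∈ L²`, whence `Λ φ = Λ'(w φ) = ∫ ⟪w G, φ⟫`. The field `u = w G ∈ L²_loc` then satisfies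
`|∫⟪u, φ⟫| ≤ M ‖φ‖_{3/2}` on test fields, and the tree's duality bound
`memLp_three_of_forall_abs_integral_inner_le` (`TestPairingLimits`: density of test fields in
`L²` of balls and testing with the truncations `|u| u 𝟙_{|x|, |u| ≤ k}`) gives `u ∈ L³` with
`‖u‖₃ ≤ M`. Uniqueness of `u` (du Bois-Reymond) is `ae_eq_of_forall_integral_inner_test_eq`
in `TestPairingLimits` and is not restated.

## Mathlib / tree search

Mathlib (this pin) has no `L^p`–`L^q` duality for `p ≠ 2` (see the search notes of
`LpDualityTestFunctions`); used here: `InnerProductSpace.toDual` (Riesz–Fréchet in Hilbert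
spaces), `exists_extension_norm_eq` (Hahn–Banach), `MeasureTheory.L2.inner_def`,
`eLpNorm_smul_le_mul_eLpNorm` (Hölder), `integrable_rpow_neg_one_add_norm_sq` (integrability
of `(1 + |x|²)^{-r/2}`, `r > dim E`), `Continuous.ae_eq_iff_eq`. Tree:
`memLp_three_of_forall_abs_integral_inner_le` (`TestPairingLimits`), `IsTestFunctionOn`
(`SobolevDomain`). The tree's `FluidPDE/SolenoidalL2Duality` performs the analogous `L²`
extension for the functional `φ ↦ ∫⟪f, φ⟫` on divergence-free test fields; the version here is
for an abstract functional on all test fields.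

## References

* I. Fonseca, G. Leoni, *Modern Methods in the Calculus of Variations: `L^p` Spaces*, Springer
  (2007), Thm. 2.37 (Riesz representation theorem in `L^p`), Thm. 2.78 (density of `C_c^∞(Ω)`
  in `L^p(Ω)`, `1 ≤ p < ∞`). Bib key `FonsecaLeoni2007`.
* H. Brezis, *Functional Analysis, Sobolev Spaces and PDE* (2011), Thm. 4.11, Thm. 5.5
  (Riesz–Fréchet). Bib key `Brezis2011`.
* P. G. Lemarié-Rieusset, *The Navier–Stokes Problem in the 21st Century* (2016), p. 573.
-/

noncomputable section

open MeasureTheory TopologicalSpace Set Function Filter Metric Module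
open _root_.Topology
open scoped ENNReal NNReal RealInnerProductSpace ContDiff

namespace Literature.Analysis.FunctionSpaces

/-! ### Algebra of test fields on the whole space -/

section TestFields

variable {X : Type*} [NormedAddCommGroup X] [NormedSpace ℝ X]
  {F : Type*} [NormedAddCommGroup F] [NormedSpace ℝ F]

/-- Sums of test functions on the whole space are test functions (Evans, *PDE*, §5.2.1).
[folklore] -/
theorem isTestFunctionOn_top_add {φ ψ : X → F} (hφ : IsTestFunctionOn (⊤ : Opens X) φ)
    (hψ : IsTestFunctionOn (⊤ : Opens X) ψ) : IsTestFunctionOn (⊤ : Opens X) (φ + ψ) :=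
  ⟨hφ.contDiff.add hψ.contDiff, hφ.hasCompactSupport.add hψ.hasCompactSupport,
    fun _ _ => trivial⟩

/-- Constant multiples of test functions on the whole space are test functions (Evans, *PDE*,
§5.2.1). [folklore] -/
theorem isTestFunctionOn_top_const_smul {φ : X → F} (hφ : IsTestFunctionOn (⊤ : Opens X) φ)
    (a : ℝ) : IsTestFunctionOn (⊤ : Opens X) (a • φ) :=
  ⟨contDiff_const.smul hφ.contDiff, hφ.hasCompactSupport.smul_left, fun _ _ => trivial⟩

/-- A smooth scalar function times a test function is a test function on the same open set
(Evans, *PDE*, §5.2.1). [folklore] -/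
theorem isTestFunctionOn_smul_left_of_contDiff {Ω : Opens X} {χ : X → ℝ} {φ : X → F}
    (hφ : IsTestFunctionOn Ω φ) (hχ : ContDiff ℝ ∞ χ) :
    IsTestFunctionOn Ω (fun x => χ x • φ x) :=
  ⟨hχ.smul hφ.contDiff, hφ.hasCompactSupport.smul_left (f := χ),
    (tsupport_smul_subset_right χ φ).trans hφ.tsupport_subset⟩

end TestFields

/-! ### Exponent bookkeeping and the weight `(1 + |x|²)^{d+1}` -/

/-- The Hölder triple `(6, 2, 3/2)`: `6⁻¹ + 2⁻¹ = (3/2)⁻¹`. [folklore] -/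
theorem holderTriple_six_two_threeHalves : ENNReal.HolderTriple 6 2 (3 / 2) := by
  refine ⟨?_⟩
  have h : ENNReal.ofReal 6⁻¹ + ENNReal.ofReal 2⁻¹ = ENNReal.ofReal (3 / 2)⁻¹ := by
    rw [← ENNReal.ofReal_add (by positivity) (by positivity)]
    norm_num
  rw [ENNReal.ofReal_inv_of_pos (by norm_num), ENNReal.ofReal_inv_of_pos (by norm_num),
    ENNReal.ofReal_inv_of_pos (by norm_num), ENNReal.ofReal_div_of_pos (by norm_num)] at h
  simpa only [ENNReal.ofReal_ofNat] using h

variable {E : Type*} [NormedAddCommGroup E] [InnerProductSpace ℝ E] [FiniteDimensional ℝ E]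
  [MeasurableSpace E] [BorelSpace E]

omit [MeasurableSpace E] [BorelSpace E] [FiniteDimensional ℝ E] in
/-- The weight `w(x) = (1 + |x|²)^{n}` is smooth. [folklore] -/
theorem contDiff_one_add_norm_sq_pow (n : ℕ) :
    ContDiff ℝ ∞ (fun x : E => (1 + ‖x‖ ^ 2) ^ n) :=
  (contDiff_const.add (contDiff_norm_sq ℝ)).pow n

omit [MeasurableSpace E] [BorelSpace E] [FiniteDimensional ℝ E] in
/-- The inverse weight `w(x)⁻¹ = (1 + |x|²)^{-n}` is smooth. [folklore] -/
theorem contDiff_inv_one_add_norm_sq_pow (n : ℕ) :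
    ContDiff ℝ ∞ (fun x : E => ((1 + ‖x‖ ^ 2) ^ n)⁻¹) :=
  (contDiff_one_add_norm_sq_pow n).inv fun x => by positivity

/-- The inverse weight `(1 + |x|²)^{-(d+1)}`, `d = dim E`, lies in `L⁶(E)`: indeed
`(1 + |x|²)^{-6(d+1)}` is integrable since `12 (d + 1) > d` (Mathlib's
`integrable_rpow_neg_one_add_norm_sq`). [folklore] -/
theorem memLp_six_inv_one_add_norm_sq_pow :
    MemLp (fun x : E => ((1 + ‖x‖ ^ 2) ^ (finrank ℝ E + 1))⁻¹) 6 (volume : Measure E) := by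
  have hmeas : AEStronglyMeasurable (fun x : E => ((1 + ‖x‖ ^ 2) ^ (finrank ℝ E + 1))⁻¹)
      (volume : Measure E) :=
    (contDiff_inv_one_add_norm_sq_pow (finrank ℝ E + 1)).continuous.aestronglyMeasurable
  have hr : (finrank ℝ E : ℝ) < 12 * ((finrank ℝ E : ℝ) + 1) := by
    linarith [(finrank ℝ E).cast_nonneg (α := ℝ)]
  have hint := integrable_rpow_neg_one_add_norm_sq (E := E) (μ := (volume : Measure E)) hr
  refine (integrable_norm_rpow_iff hmeas (by norm_num) (by norm_num)).1
    (hint.congr (Eventually.of_forall fun x => ?_))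
  have ha : 0 < 1 + ‖x‖ ^ 2 := by positivity
  have h1 : (1 + ‖x‖ ^ 2) ^ (-((finrank ℝ E : ℝ) + 1)) = ((1 + ‖x‖ ^ 2) ^ (finrank ℝ E + 1))⁻¹ := by
    rw [Real.rpow_neg ha.le, ← Nat.cast_succ, Real.rpow_natCast]
  dsimp only
  rw [ENNReal.toReal_ofNat, Real.norm_of_nonneg (inv_nonneg.2 (pow_nonneg ha.le _)), ← h1,
    ← Real.rpow_mul ha.le]
  congr 1
  ring

/-- **Hölder with the weight**: `‖w⁻¹ f‖_{3/2} ≤ ‖w⁻¹‖₆ ‖f‖₂` for `w = (1 + |x|²)^{d+1}`.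
[folklore] -/
theorem eLpNorm_inv_weight_smul_le {f : E → E} (hf : AEStronglyMeasurable f volume) :
    eLpNorm (fun x => ((1 + ‖x‖ ^ 2) ^ (finrank ℝ E + 1))⁻¹ • f x) (3 / 2) volume ≤
      eLpNorm (fun x : E => ((1 + ‖x‖ ^ 2) ^ (finrank ℝ E + 1))⁻¹) 6 volume *
        eLpNorm f 2 volume := by
  haveI := holderTriple_six_two_threeHalves
  exact eLpNorm_smul_le_mul_eLpNorm hf memLp_six_inv_one_add_norm_sq_pow.aestronglyMeasurable

/-! ### `(L²)* = L²` for functionals on test fields -/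

/-- **Riesz representation in `L²(E; E)` for functionals given on test fields.** Let `Λ` be a
real functional on fields `E → E` which is additive and real homogeneous on the test fields
`C_c^∞(E; E)` and satisfies `|Λ φ| ≤ C ‖φ‖_{L²}` there. Then there is `G ∈ L²(E; E)` with
`Λ φ = ∫ ⟪G(x), φ(x)⟫ dx` for every test field `φ`. (The classes of test fields form a subspace
of `L²(E; E)` on which `Λ` induces a bounded linear functional — a.e. equal continuous fields
are equal —, which extends to `L²` by Hahn–Banach and is represented by Riesz–Fréchet,
Brezis 2011, Thm. 5.5.) [folklore] -/
theorem exists_memLp_two_repr_of_testField_bound (Λ : (E → E) → ℝ)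
    (hadd : ∀ f g : E → E, IsTestFunctionOn (⊤ : Opens E) f →
      IsTestFunctionOn (⊤ : Opens E) g → Λ (f + g) = Λ f + Λ g)
    (hsmul : ∀ (a : ℝ) (f : E → E), IsTestFunctionOn (⊤ : Opens E) f → Λ (a • f) = a * Λ f)
    {C : ℝ} (hbd : ∀ f : E → E, IsTestFunctionOn (⊤ : Opens E) f →
      |Λ f| ≤ C * (eLpNorm f 2 volume).toReal) :
    ∃ G : E → E, MemLp G 2 volume ∧
      ∀ f : E → E, IsTestFunctionOn (⊤ : Opens E) f → Λ f = ∫ x, ⟪G x, f x⟫ := by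
  -- a.e. equal test fields are equal
  have huniq : ∀ {ψ χ : E → E}, IsTestFunctionOn (⊤ : Opens E) ψ →
      IsTestFunctionOn (⊤ : Opens E) χ → ψ =ᵐ[volume] χ → ψ = χ := fun hψ hχ h =>
    (Continuous.ae_eq_iff_eq volume hψ.contDiff.continuous hχ.contDiff.continuous).1 h
  -- the subspace of `L²` classes of test fields
  let P : Submodule ℝ (Lp E 2 (volume : Measure E)) :=
    { carrier := {F | ∃ ψ : E → E, IsTestFunctionOn (⊤ : Opens E) ψ ∧
        (F : E → E) =ᵐ[volume] ψ}
      zero_mem' := ⟨0, isTestFunctionOn_zero _, Lp.coeFn_zero E 2 volume⟩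
      add_mem' := by
        rintro F G ⟨ψ, hψ, hF⟩ ⟨χ, hχ, hG⟩
        exact ⟨ψ + χ, isTestFunctionOn_top_add hψ hχ, (Lp.coeFn_add F G).trans (hF.add hG)⟩
      smul_mem' := by
        rintro a F ⟨ψ, hψ, hF⟩
        exact ⟨a • ψ, isTestFunctionOn_top_const_smul hψ a,
          (Lp.coeFn_smul a F).trans (hF.const_smul a)⟩ }
  have hmemP : ∀ {F : Lp E 2 (volume : Measure E)}, F ∈ P ↔
      ∃ ψ : E → E, IsTestFunctionOn (⊤ : Opens E) ψ ∧ (F : E → E) =ᵐ[volume] ψ :=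
    Iff.rfl
  -- the test representative of a class in `P`
  let rep : P → E → E := fun F => Classical.choose (hmemP.1 F.2)
  have hrep : ∀ F : P, IsTestFunctionOn (⊤ : Opens E) (rep F) ∧
      ((F : Lp E 2 (volume : Measure E)) : E → E) =ᵐ[volume] rep F :=
    fun F => Classical.choose_spec (hmemP.1 F.2)
  have hrep_add : ∀ F G : P, rep (F + G) = rep F + rep G := by
    intro F G
    refine huniq (hrep _).1 (isTestFunctionOn_top_add (hrep F).1 (hrep G).1) ?_
    have h1 := (hrep (F + G)).2
    rw [Submodule.coe_add] at h1
    exact h1.symm.trans ((Lp.coeFn_add (F : Lp E 2 (volume : Measure E))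
      (G : Lp E 2 (volume : Measure E))).trans ((hrep F).2.add (hrep G).2))
  have hrep_smul : ∀ (a : ℝ) (F : P), rep (a • F) = a • rep F := by
    intro a F
    refine huniq (hrep _).1 (isTestFunctionOn_top_const_smul (hrep F).1 a) ?_
    have h1 := (hrep (a • F)).2
    rw [Submodule.coe_smul] at h1
    exact h1.symm.trans ((Lp.coeFn_smul a (F : Lp E 2 (volume : Measure E))).trans
      ((hrep F).2.const_smul a))
  -- `Λ` as a bounded linear functional on `P`
  let L₁ : P →ₗ[ℝ] ℝ :=
    { toFun := fun F => Λ (rep F)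
      map_add' := fun F G => by
        show Λ (rep (F + G)) = Λ (rep F) + Λ (rep G)
        rw [hrep_add, hadd _ _ (hrep F).1 (hrep G).1]
      map_smul' := fun a F => by
        show Λ (rep (a • F)) = a * Λ (rep F)
        rw [hrep_smul, hsmul _ _ (hrep F).1] }
  have hL₁ : ∀ F : P, L₁ F = Λ (rep F) := fun F => rfl
  have hbound : ∀ F : P, ‖L₁ F‖ ≤ C * ‖F‖ := by
    intro F
    rw [hL₁, Real.norm_eq_abs, Submodule.coe_norm, Lp.norm_def, eLpNorm_congr_ae (hrep F).2]
    exact hbd _ (hrep F).1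
  let L₂ : P →L[ℝ] ℝ := L₁.mkContinuous C hbound
  have hL₂ : ∀ F : P, L₂ F = Λ (rep F) := fun F => rfl
  -- Hahn–Banach and Riesz–Fréchet
  obtain ⟨g, hg, -⟩ := exists_extension_norm_eq P L₂
  set G : Lp E 2 (volume : Measure E) :=
    (InnerProductSpace.toDual ℝ (Lp E 2 (volume : Measure E))).symm g with hG
  refine ⟨G, Lp.memLp G, fun f hf => ?_⟩
  have hf2 : MemLp f 2 (volume : Measure E) :=
    hf.contDiff.continuous.memLp_of_hasCompactSupport hf.hasCompactSupport
  have hFP : hf2.toLp f ∈ P := ⟨f, hf, hf2.coeFn_toLp⟩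
  have h1 : g (hf2.toLp f) = Λ f := by
    rw [hg ⟨_, hFP⟩, hL₂]
    congr 1
    exact huniq (hrep _).1 hf ((hrep ⟨_, hFP⟩).2.symm.trans hf2.coeFn_toLp)
  have h2 : g (hf2.toLp f) = ∫ x, ⟪G x, f x⟫ := by
    rw [← InnerProductSpace.toDual_symm_apply (𝕜 := ℝ) (x := hf2.toLp f) (y := g), ← hG,
      MeasureTheory.L2.inner_def]
    exact integral_congr_ae (hf2.coeFn_toLp.mono fun x hx => by dsimp only; rw [hx])
  rw [← h1, h2]

/-! ### `(L^{3/2})* = L³` for functionals on test fields -/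

/-- **Riesz representation theorem `L³ = (L^{3/2})*` for functionals given on test fields**
(Fonseca–Leoni 2007, Thm. 2.37: for `1 < p < ∞` every bounded linear functional on `L^p` is
`u ↦ ∫ u v dμ` for a unique `v ∈ L^q`, `‖v‖_q = ‖L‖`; with Thm. 2.78: `C_c^∞` is dense in
`L^p`, `1 ≤ p < ∞`; here `p = 3/2`, `q = 3`, `E`-valued fields paired by `∫ ⟪v, u⟫`). Let
`0 ≤ M` and let `Λ` be a real functional on fields `E → E` which is additive and real homogeneous
on the test fields `C_c^∞(E; E)` with `|Λ φ| ≤ M ‖φ‖_{L^{3/2}}` there. Then there is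
`u ∈ L³(E; E)` with `‖u‖_{L³} ≤ M` and `Λ φ = ∫ ⟪u(x), φ(x)⟫ dx` for every test field `φ`.
Proof: module docstring (weight `(1 + |x|²)^{d+1}`, Hölder `(6, 2, 3/2)`, the `L²` statement,
and the duality bound `memLp_three_of_forall_abs_integral_inner_le`).
[cite: FonsecaLeoni2007, Thm. 2.37 with Thm. 2.78] -/
theorem exists_memLp_three_repr_of_testField_bound (Λ : (E → E) → ℝ)
    (hadd : ∀ f g : E → E, IsTestFunctionOn (⊤ : Opens E) f →
      IsTestFunctionOn (⊤ : Opens E) g → Λ (f + g) = Λ f + Λ g)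
    (hsmul : ∀ (a : ℝ) (f : E → E), IsTestFunctionOn (⊤ : Opens E) f → Λ (a • f) = a * Λ f)
    {M : ℝ} (hM : 0 ≤ M) (hbd : ∀ f : E → E, IsTestFunctionOn (⊤ : Opens E) f →
      |Λ f| ≤ M * (eLpNorm f (3 / 2 : ℝ≥0∞) volume).toReal) :
    ∃ u : E → E, MemLp u 3 volume ∧ eLpNorm u 3 volume ≤ ENNReal.ofReal M ∧
      ∀ f : E → E, IsTestFunctionOn (⊤ : Opens E) f → Λ f = ∫ x, ⟪u x, f x⟫ := by
  -- ### the weight `w = (1 + |x|²)^{d+1}` and its inverse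
  set w : E → ℝ := fun x => (1 + ‖x‖ ^ 2) ^ (finrank ℝ E + 1) with hw_def
  have hw0 : ∀ x, 0 < w x := fun x => by positivity
  have hw : ContDiff ℝ ∞ w := contDiff_one_add_norm_sq_pow (finrank ℝ E + 1)
  have hwi : ContDiff ℝ ∞ (fun x => (w x)⁻¹) := contDiff_inv_one_add_norm_sq_pow (finrank ℝ E + 1)
  have hω6 : MemLp (fun x => (w x)⁻¹) 6 (volume : Measure E) := memLp_six_inv_one_add_norm_sq_pow
  have htest_ω : ∀ {f : E → E}, IsTestFunctionOn (⊤ : Opens E) f →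
      IsTestFunctionOn (⊤ : Opens E) (fun x => (w x)⁻¹ • f x) :=
    fun hf => isTestFunctionOn_smul_left_of_contDiff hf hwi
  have htest_w : ∀ {f : E → E}, IsTestFunctionOn (⊤ : Opens E) f →
      IsTestFunctionOn (⊤ : Opens E) (fun x => w x • f x) :=
    fun hf => isTestFunctionOn_smul_left_of_contDiff hf hw
  -- ### the weighted functional `Λ' ψ = Λ (w⁻¹ ψ)` is `L²`-bounded on test fields
  set Λ' : (E → E) → ℝ := fun f => Λ (fun x => (w x)⁻¹ • f x) with hΛ'
  have hadd' : ∀ f g : E → E, IsTestFunctionOn (⊤ : Opens E) f →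
      IsTestFunctionOn (⊤ : Opens E) g → Λ' (f + g) = Λ' f + Λ' g := by
    intro f g hf hg
    have e : (fun x => (w x)⁻¹ • (f + g) x) =
        (fun x => (w x)⁻¹ • f x) + fun x => (w x)⁻¹ • g x := by
      funext x
      simp only [Pi.add_apply, smul_add]
    simp only [hΛ']
    rw [e]
    exact hadd _ _ (htest_ω hf) (htest_ω hg)
  have hsmul' : ∀ (a : ℝ) (f : E → E), IsTestFunctionOn (⊤ : Opens E) f →
      Λ' (a • f) = a * Λ' f := by
    intro a f hf
    have e : (fun x => (w x)⁻¹ • (a • f) x) = a • fun x => (w x)⁻¹ • f x := by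
      funext x
      simp only [Pi.smul_apply, smul_smul, mul_comm]
    simp only [hΛ']
    rw [e]
    exact hsmul a _ (htest_ω hf)
  set C : ℝ := M * (eLpNorm (fun x => (w x)⁻¹) 6 (volume : Measure E)).toReal with hC
  have hbd' : ∀ f : E → E, IsTestFunctionOn (⊤ : Opens E) f →
      |Λ' f| ≤ C * (eLpNorm f 2 volume).toReal := by
    intro f hf
    have hf2 : MemLp f 2 (volume : Measure E) :=
      hf.contDiff.continuous.memLp_of_hasCompactSupport hf.hasCompactSupport
    have hH : eLpNorm (fun x => (w x)⁻¹ • f x) (3 / 2) volume ≤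
        eLpNorm (fun x => (w x)⁻¹) 6 volume * eLpNorm f 2 volume :=
      eLpNorm_inv_weight_smul_le hf2.aestronglyMeasurable
    have hfin : eLpNorm (fun x => (w x)⁻¹) 6 volume * eLpNorm f 2 volume ≠ ⊤ :=
      ENNReal.mul_ne_top hω6.eLpNorm_ne_top hf2.eLpNorm_ne_top
    calc |Λ' f| = |Λ (fun x => (w x)⁻¹ • f x)| := rfl
      _ ≤ M * (eLpNorm (fun x => (w x)⁻¹ • f x) (3 / 2) volume).toReal := hbd _ (htest_ω hf)
      _ ≤ M * (eLpNorm (fun x => (w x)⁻¹) 6 volume * eLpNorm f 2 volume).toReal :=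
          mul_le_mul_of_nonneg_left (ENNReal.toReal_mono hfin hH) hM
      _ = C * (eLpNorm f 2 volume).toReal := by rw [hC, ENNReal.toReal_mul, mul_assoc]
  -- ### `L²` representation of `Λ'` and the field `u = w G`
  obtain ⟨G, hG, hGrepr⟩ := exists_memLp_two_repr_of_testField_bound Λ' hadd' hsmul' hbd'
  set u : E → E := fun x => w x • G x with hu
  have hrepr : ∀ f : E → E, IsTestFunctionOn (⊤ : Opens E) f → Λ f = ∫ x, ⟪u x, f x⟫ := by
    intro f hf
    have h1 : Λ f = Λ' (fun x => w x • f x) := by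
      simp only [hΛ']
      congr 1
      funext x
      rw [smul_smul, inv_mul_cancel₀ (hw0 x).ne', one_smul]
    rw [h1, hGrepr _ (htest_w hf)]
    refine integral_congr_ae (Eventually.of_forall fun x => ?_)
    simp only [hu]
    rw [real_inner_smul_left, real_inner_smul_right]
  -- ### `u ∈ L²_loc`, hence `u ∈ L³` with `‖u‖₃ ≤ M` by duality
  have hum : AEStronglyMeasurable u volume :=
    hw.continuous.aestronglyMeasurable.smul hG.aestronglyMeasurable
  have hu2 : LocallyIntegrable (fun x => ‖u x‖ ^ 2) volume := by
    have hG2 : Integrable (fun x => ‖G x‖ ^ 2) volume :=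
      (memLp_two_iff_integrable_sq_norm hG.aestronglyMeasurable).1 hG
    have h1 : LocallyIntegrable (fun x => w x ^ 2 * ‖G x‖ ^ 2) volume := by
      rw [← locallyIntegrableOn_univ]
      exact (hG2.locallyIntegrable.locallyIntegrableOn univ).continuousOn_mul
        (hw.continuous.pow 2).continuousOn isOpen_univ.isLocallyClosed
    have e : (fun x => ‖u x‖ ^ 2) = fun x => w x ^ 2 * ‖G x‖ ^ 2 := by
      funext x
      simp only [hu]
      rw [norm_smul, mul_pow, Real.norm_of_nonneg (hw0 x).le]
    rw [e]
    exact h1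
  have hbd_u : ∀ φ : E → E, IsTestFunctionOn (⊤ : Opens E) φ →
      |∫ x, ⟪u x, φ x⟫| ≤ M * (eLpNorm φ (3 / 2 : ℝ≥0∞) volume).toReal := by
    intro φ hφ
    rw [← hrepr φ hφ]
    exact hbd φ hφ
  obtain ⟨hu3, hu3le⟩ := memLp_three_of_forall_abs_integral_inner_le hum hu2 hM hbd_u
  exact ⟨u, hu3, hu3le, hrepr⟩

end Literature.Analysis.FunctionSpaces
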